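import Summits.NavierStokesRegularity.NavierStokesRegularity.Theorems.DssFarFieldSlavingBlowupTypeIDssProfileSimilarityEnstrophyCoulombThreshold
import Summits.NavierStokesRegularity.NavierStokesRegularity.Theorems.DssFarFieldSlavingBlowupTypeIDssProfileSimilarityEnstrophyUnconditional
import Summits.NavierStokesRegularity.NavierStokesRegularity.Theorems.DssFarFieldSlavingBlowupTypeIDssProfileGaussianSmallTypeI
import Summits.NavierStokesRegularity.NavierStokesRegularity.Theorems.DssFarFieldSlavingBlowupTypeIDssProfileSimilarityEnstrophyTimeConstantFloor
import Summits.NavierStokesRegularity.NavierStokesRegularity.Theorems.DssFarFieldSlavingBlowupTypeIDssProfileControlsClassLevel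
import Summits.NavierStokesRegularity.NavierStokesRegularity.Theorems.DssFarFieldSlavingBlowupTypeIDssProfileReversingInfiniteOrderTwist
import Summits.NavierStokesRegularity.NavierStokesRegularity.Theorems.DssFarFieldSlavingBlowupTypeIDssProfileSimilarityEnstrophyBeltramiLiouville
import Summits.NavierStokesRegularity.NavierStokesRegularity.Theorems.DssFarFieldSlavingBlowupTypeIDssProfileSubcriticalStrain
import Summits.NavierStokesRegularity.NavierStokesRegularity.Theorems.DssFarFieldSlavingBlowupTypeIDssProfileDoubleCone
import Summits.NavierStokesRegularity.NavierStokesRegularity.Theorems.DssFarFieldSlavingBlowupTypeIDssProfileSimilarityEnstrophyMixedThreshold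
import Summits.NavierStokesRegularity.NavierStokesRegularity.Theorems.DssFarFieldSlavingBlowupTypeIDssProfileSimilarityEnstrophySpaceThreshold
import Summits.NavierStokesRegularity.NavierStokesRegularity.Theorems.DssFarFieldSlavingBlowupTypeIDssProfileGaussianTwoConstant
import Summits.NavierStokesRegularity.NavierStokesRegularity.Theorems.DssFarFieldSlavingBlowupTypeIDssProfileFixedTwistEmpty
import Summits.NavierStokesRegularity.NavierStokesRegularity.Theorems.DssFarFieldSlavingBlowupTypeIDssProfileTiltedIsotropyInfiniteTwist
import Summits.NavierStokesRegularity.NavierStokesRegularity.Theorems.DssFarFieldSlavingBlowupTypeIDssProfileSpatioTemporal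
import Summits.NavierStokesRegularity.NavierStokesRegularity.Theorems.TypeIDSSLiouvilleConjecture
import HarnessLib.Audit
import HarnessLib

/-!
# Blow-up scenario census — block D, the rows whose closers sit in the `DssFarFieldSlaving` cone
# (D6 small-constant windows, D7c symmetry / analytic side conditions, D7d double cone)

Cone annex of `ScenarioCensusSelfSimilar.lean` (cell `pub/ns-census`, `SCENARIO-CENSUS.md` v1.8–v1.12,
rows D6 / D7c / D7d; refuter `RDSS-INDEX.txt` = the 70 `rdssClass_*` decls with FQNs).  The closing
theorems live in `Theorems/DssFarFieldSlavingBlowupTypeIDssProfile*.lean`, which import the route file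
`Theses.DssFarFieldSlaving` (+ four more routes); hence this separate file (theses-cone warning accepted
knowingly, as for `ScenarioCensusForwardF1a.lean` and typer-2's `ScenarioCensusRotatingCone.lean`).

**The class.** All these theorems speak about ONE hypothesis class — the census's `rdssClass M`:
triples `(c, R, u)` with `1 < c`, `u` an ancient mild solution (`ν = 1`) with measurable slices,
rotated discretely self-similar `IsRotatedDSS c R u` (any `R ∈ O(3)`; the DSS structure is UNUSED by
the D6 / analytic closers — «DSS-blind» Liouville theorems for the space–time Type-I envelope), the
envelope `HasTypeIDecay M u` (`‖u(t,x)‖ ≤ M/(‖x‖ + √(−t))`), and `u` not a.e. trivial.  It is named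
here once (`RdssClassEmpty M`, and `RdssClassEmptyUnder M P` for a side condition `P`), so that every
row is two lines; `rdssClassEmpty_forall_iff` identifies «empty for EVERY `M`» with the conjecture leaf
`SUM.TypeIDSSLiouvilleConjecture` (rows D7 ∧ R4), and `rdssClassEmptyUnder_of_rdssClassEmpty` records
that every side-condition row is a sub-cell of it.

| key | cell (side condition on the class at envelope constant `M`) | closer (`STH.` = `…Theorems.`) |
|---|---|---|
| D6a | `M⁴ < 1024/27` (`M < 2.4816`, widest window) | `SimilarityEnstrophy.rdssClass_empty_of_typeI_pow_four_lt_coulomb` |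
| D6b | `M < 1` | `SimilarityEnstrophy.rdssClass_empty_of_typeI_lt_one` |
| D6g | `4M² + (3√6/4)M < 1` (`M < 0.3206`, Gaussian route) | `GaussianGap.rdssClass_empty_of_gaussianSmallTypeI` |
| D6t | any `M`; every smooth Type-I representative has TIME rate `√(−t)‖V‖ ≤ θ < 1` | `SimilarityEnstrophy.rdssClass_empty_of_timeConstant` |
| D7cS | self-similar members (`IsSelfSimilar u`) | `ControlsClassLevel.rdssClass_selfSimilar_empty` |
| D7cR | twist `rotZLIE θ` of INFINITE order (`θ/π ∉ ℚ`) + a.e. equivariance under a rotation-reversing isometry | `ReversingIsotropy.rdssClass_reversing_infiniteOrder_empty` |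
| D7cB | generalised Beltrami representatives `curl(ω × V) = 0` | `SimilarityEnstrophy.rdssClass_generalisedBeltrami_empty_unconditional` |
| D7cΛ | subcritical strain `⟪∇V ξ, ξ⟫ ≤ Λ‖ξ‖²/(−t)`, `Λ < 1` | `SubcriticalStrain.rdssClass_subcriticalStrain_empty` |
| D7d | vorticity direction in a double cone where `|ω| > M₀` (locally suitable representative) | `DoubleCone.rdssClass_doubleCone_empty` — CONDITIONAL on `LeiRenTian2025_doubleCone_regularity` (row F17) |

The other ≈ 25 unconditional closers of census rows D6 / D7c (Coulomb / mixed / space thresholds,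
sign-coherent Gaussian classes, strain budget, Hardy stretching, periodic majorants, certificate,
cross-flow, Lamb direction, curl-Lamb defect, Gaussian gap, tilted / corotating isotropy, spatio-temporal
reversing, m-fold LARGE order = typer-2's `Row_A9pMild`, rotating mirrors = typer-2's `Row_R6b–d`) are
cited by name in the census; CONDITIONAL wrappers (`ExplicitThreshold.*`, `…_of_decay_of_typeI_lt_one`,
`…hardyStretching_empty`) are NOT exclusions (ref H3).  **Nothing here is a claim about Navier–Stokes
regularity; no summit statement is proved by this seat.**
-/

noncomputable section

-- the summit and its single problem share the name `NavierStokesRegularity` (D-0017 nested layout)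
set_option linter.dupNamespace false

open Set Function Filter Topology MeasureTheory
open scoped RealInnerProductSpace

namespace Summit.NavierStokesRegularity.NavierStokesRegularity.Theorems.ScenarioCensus

open Literature.Analysis Literature.Analysis.FluidPDE
open Summit.NavierStokesRegularity.NavierStokesRegularity.Theorems

/-! ## The class, named once -/

/-- **The census's `rdssClass M` is EMPTY**: there is no `(c, R, u)` with `1 < c`, `u` ancient mild
(`ν = 1`) with measurable slices, rotated `c`-DSS for the isometry `R`, Type-I envelope
`‖u(t,x)‖ ≤ M/(‖x‖+√(−t))`, and `u` not a.e. trivial on the slices `t < 0`.  The hypothesis class of the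
truncation bridges of route `DssFarFieldSlaving` (crux ⟨0155⟩ `BlowupTypeIDssProfile` asserts a member).
[folklore] -/
def RdssClassEmpty (M : ℝ) : Prop :=
  ¬ ∃ (c : ℝ) (R : (EuclideanSpace ℝ (Fin 3)) ≃ₗᵢ[ℝ] (EuclideanSpace ℝ (Fin 3)))
      (u : ℝ → (EuclideanSpace ℝ (Fin 3)) → (EuclideanSpace ℝ (Fin 3))),
    1 < c ∧ IsAncientMildSolution 1 u ∧ (∀ t < 0, AEStronglyMeasurable (u t) volume) ∧
    IsRotatedDSS c R u ∧ HasTypeIDecay M u ∧ ¬ (∀ t < 0, u t =ᵐ[volume] 0)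

/-- **The sub-class cut out by a side condition `P u` is EMPTY** (same binders, `P u` inserted before
the non-triviality clause — the shape of the tree's `rdssClass_*_empty` theorems). [folklore] -/
def RdssClassEmptyUnder (M : ℝ)
    (P : (ℝ → (EuclideanSpace ℝ (Fin 3)) → (EuclideanSpace ℝ (Fin 3))) → Prop) : Prop :=
  ¬ ∃ (c : ℝ) (R : (EuclideanSpace ℝ (Fin 3)) ≃ₗᵢ[ℝ] (EuclideanSpace ℝ (Fin 3)))
      (u : ℝ → (EuclideanSpace ℝ (Fin 3)) → (EuclideanSpace ℝ (Fin 3))),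
    1 < c ∧ IsAncientMildSolution 1 u ∧ (∀ t < 0, AEStronglyMeasurable (u t) volume) ∧
    IsRotatedDSS c R u ∧ HasTypeIDecay M u ∧ P u ∧ ¬ (∀ t < 0, u t =ᵐ[volume] 0)

/-- A side condition only shrinks the class: every D7c-type row is a sub-cell of `RdssClassEmpty M`.
[folklore] -/
theorem rdssClassEmptyUnder_of_rdssClassEmpty {M : ℝ} (h : RdssClassEmpty M)
    (P : (ℝ → (EuclideanSpace ℝ (Fin 3)) → (EuclideanSpace ℝ (Fin 3))) → Prop) :
    RdssClassEmptyUnder M P := by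
  rintro ⟨c, R, u, hc, hmild, hmeas, hR, hdec, -, hne⟩
  exact h ⟨c, R, u, hc, hmild, hmeas, hR, hdec, hne⟩

/-- «Empty for every envelope constant» is the rotated Type-I DSS Liouville statement for every factor
and every isometry (`RotatedTypeIDSSLiouville c R`, which quantifies the constant existentially).
[cite: BradshawTsai2017CPDE, §5 Open Problem 5.1] -/
theorem rdssClassEmpty_forall_iff_rotated :
    (∀ M : ℝ, RdssClassEmpty M) ↔
      ∀ (c : ℝ) (R : (EuclideanSpace ℝ (Fin 3)) ≃ₗᵢ[ℝ] (EuclideanSpace ℝ (Fin 3))),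
        RotatedTypeIDSSLiouville c R := by
  constructor
  · intro h c R hc u hmild hmeas hR hdec
    obtain ⟨C₀, hC₀⟩ := hdec
    by_contra hne
    exact h C₀ ⟨c, R, u, hc, hmild, hmeas, hR, hC₀, hne⟩
  · rintro h M ⟨c, R, u, hc, hmild, hmeas, hR, hdec, hne⟩
    exact hne (h c R hc u hmild hmeas hR ⟨M, hdec⟩)

/-- **Rows D6/D7c/D7d are sub-cells of the conjecture leaf**: `rdssClass M` is empty for EVERY `M` iff
`SUM.TypeIDSSLiouvilleConjecture` (= census rows D7 ∧ R4; the un-rotated conjunct is the case `R = 1`,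
`rotatedTypeIDSSLiouville_refl_iff`). [cite: BradshawTsai2017CPDE, §5 Open Problem 5.1] -/
theorem rdssClassEmpty_forall_iff_conjecture :
    (∀ M : ℝ, RdssClassEmpty M) ↔
      Summit.NavierStokesRegularity.NavierStokesRegularity.TypeIDSSLiouvilleConjecture := by
  rw [rdssClassEmpty_forall_iff_rotated]
  refine ⟨fun h c => ⟨?_, fun R => h c R⟩, fun h c R => (h c).2 R⟩
  exact (rotatedTypeIDSSLiouville_refl_iff c).1 (h c (LinearIsometryEquiv.refl ℝ _))

/-! ## D6: small-constant windows (unconditional; DSS-blind) -/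

/-- **Row D6a** (Type I · any factor, any twist · envelope constant `M⁴ < 1024/27`, i.e. `M < 2.4816` —
the WIDEST unconditional window of the census): the class is empty.  EXCLUDED-IN-TREE
(`SimilarityEnstrophy.rdssClass_empty_of_typeI_pow_four_lt_coulomb`: Coulomb-threshold similarity
enstrophy identity). (ref: tree route DssFarFieldSlaving, theory (4)) -/
def Row_D6a : Prop := ∀ M : ℝ, M ^ 4 < 1024 / 27 → RdssClassEmpty M

/-- Row D6a is a theorem of the tree. [folklore] -/
theorem row_D6a_excluded : Row_D6a := fun _ hM =>
  SimilarityEnstrophy.rdssClass_empty_of_typeI_pow_four_lt_coulomb hM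

/-- **Row D6b** (envelope constant `M < 1`): the class is empty.  EXCLUDED-IN-TREE
(`SimilarityEnstrophy.rdssClass_empty_of_typeI_lt_one`; = Chae–Wolf 2017 Rem. 1.4's small-constant
Liouville in the mild class with explicit constant `1`). (ref: ChaeWolf2017RemovingDSS, Rem. 1.4) -/
def Row_D6b : Prop := ∀ M : ℝ, M < 1 → RdssClassEmpty M

/-- Row D6b is a theorem of the tree. [folklore] -/
theorem row_D6b_excluded : Row_D6b := fun _ hM => SimilarityEnstrophy.rdssClass_empty_of_typeI_lt_one hM

/-- **Row D6g** (Gaussian-weighted window `4M² + (3√6/4)M < 1`, `M < 0.3206`): the class is empty.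
EXCLUDED-IN-TREE (`GaussianGap.rdssClass_empty_of_gaussianSmallTypeI`; listed because its proof route
— the Gaussian head-pressure identity — is different, not because the window is wider). (ref: tree) -/
def Row_D6g : Prop := ∀ M : ℝ, 4 * M ^ 2 + (3 * Real.sqrt 6 / 4) * M < 1 → RdssClassEmpty M

/-- Row D6g is a theorem of the tree. [folklore] -/
theorem row_D6g_excluded : Row_D6g := fun _ hM => GaussianGap.rdssClass_empty_of_gaussianSmallTypeI hM

/-- **Row D6t** (ANY envelope constant `M`; side condition: every smooth Type-I representative `V` of
the member has TIME-ONLY rate `√(−t) ‖V(t,x)‖ ≤ θ` with `θ < 1` — the «portrait» form of the time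
threshold): the sub-class is empty.  EXCLUDED-IN-TREE (`SimilarityEnstrophy.rdssClass_empty_of_timeConstant`).
(ref: tree; cf. census A2a `typeI_ancient_eq_zero_of_timeConstant_lt_one`) -/
def Row_D6t : Prop :=
  ∀ M θ : ℝ, θ < 1 → RdssClassEmptyUnder M fun u =>
    ∀ V : ℝ → EuclideanSpace ℝ (Fin 3) → EuclideanSpace ℝ (Fin 3), IsTypeIAncientMild M V →
      (∀ t < 0, V t =ᵐ[volume] u t) → ∀ t < 0, ∀ x, Real.sqrt (-t) * ‖V t x‖ ≤ θ

/-- Row D6t is a theorem of the tree. [folklore] -/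
theorem row_D6t_excluded : Row_D6t := fun M _ hθ => SimilarityEnstrophy.rdssClass_empty_of_timeConstant M hθ

/-! ## D7c: symmetry and analytic side conditions (representatives) -/

/-- **Row D7cS** (SELF-SIMILAR members, `IsSelfSimilar u`, any `M`): empty — continuously self-similar
Type-I ancient mild solutions are trivial (Tsai 1998 for bounded profiles, in the mild class).
EXCLUDED-IN-TREE (`ControlsClassLevel.rdssClass_selfSimilar_empty`). (ref: Tsai1998, Thm 1; tree) -/
def Row_D7cS : Prop := ∀ M : ℝ, RdssClassEmptyUnder M IsSelfSimilar

/-- Row D7cS is a theorem of the tree. [folklore] -/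
theorem row_D7cS_excluded : Row_D7cS := fun M => ControlsClassLevel.rdssClass_selfSimilar_empty M

/-- **Row D7cR** (twist `R = rotZLIE θ` of INFINITE order, `θ/π` irrational, and every slice a.e.
equivariant under a linear isometry `g` that REVERSES rotations about the axis, `g R_φ = R_{−φ} g`):
no such member — the statement of `ReversingIsotropy.rdssClass_reversing_infiniteOrder_empty` verbatim
(here `R` is fixed, so the class binder is `(c, u)`).  EXCLUDED-IN-TREE. (ref: tree route
DssFarFieldSlaving, T-series «reversing isotropy») -/
def Row_D7cR : Prop :=
  ∀ (θ : ℝ), Irrational (θ / Real.pi) →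
    ∀ (g : (EuclideanSpace ℝ (Fin 3)) ≃ₗᵢ[ℝ] (EuclideanSpace ℝ (Fin 3))),
    (∀ φ y, g (rotZ φ y) = rotZ (-φ) (g y)) → ∀ (M : ℝ),
    ¬ ∃ (c : ℝ) (u : ℝ → (EuclideanSpace ℝ (Fin 3)) → (EuclideanSpace ℝ (Fin 3))),
      1 < c ∧ IsAncientMildSolution 1 u ∧ (∀ t < 0, AEStronglyMeasurable (u t) volume) ∧
      IsRotatedDSS c (rotZLIE θ) u ∧ HasTypeIDecay M u ∧
      (∀ t < 0, (fun x => u t (g x)) =ᵐ[volume] fun x => g (u t x)) ∧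
      ¬ (∀ t < 0, u t =ᵐ[volume] 0)

/-- Row D7cR is a theorem of the tree. [folklore] -/
theorem row_D7cR_excluded : Row_D7cR := fun _ hθ _ hg M =>
  ReversingIsotropy.rdssClass_reversing_infiniteOrder_empty hθ hg M

/-- **Row D7cB** (GENERALISED BELTRAMI representatives: every smooth Type-I representative `V` has
`curl (ω × V) = 0`, any `M`): empty, UNCONDITIONALLY
(`SimilarityEnstrophy.rdssClass_generalisedBeltrami_empty_unconditional`; the short name
`ExplicitThreshold.rdssClass_generalisedBeltrami_empty` is the CONDITIONAL twin, not an exclusion).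
EXCLUDED-IN-TREE. (ref: tree) -/
def Row_D7cB : Prop :=
  ∀ M : ℝ, RdssClassEmptyUnder M fun u =>
    ∀ V : ℝ → EuclideanSpace ℝ (Fin 3) → EuclideanSpace ℝ (Fin 3), IsTypeIAncientMild M V →
      (∀ t < 0, V t =ᵐ[volume] u t) →
      ∀ t < 0, ∀ x, curl (fun y => cross (curl (V t) y) (V t y)) x = 0

/-- Row D7cB is a theorem of the tree. [folklore] -/
theorem row_D7cB_excluded : Row_D7cB := fun M =>
  SimilarityEnstrophy.rdssClass_generalisedBeltrami_empty_unconditional M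

/-- **Row D7cΛ** (SUBCRITICAL STRAIN: every smooth Type-I representative has
`⟪∇V(t,x) ξ, ξ⟫ ≤ Λ ‖ξ‖²/(−t)` with `Λ < 1`, any `M`): empty
(`SubcriticalStrain.rdssClass_subcriticalStrain_empty` = `ExplicitThreshold.…_unconditional`).
EXCLUDED-IN-TREE. (ref: tree) -/
def Row_D7cL : Prop :=
  ∀ M Λ : ℝ, Λ < 1 → RdssClassEmptyUnder M fun u =>
    ∀ V : ℝ → EuclideanSpace ℝ (Fin 3) → EuclideanSpace ℝ (Fin 3), IsTypeIAncientMild M V →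
      (∀ t < 0, V t =ᵐ[volume] u t) →
      ∀ t < 0, ∀ x ξ : EuclideanSpace ℝ (Fin 3), ⟪fderiv ℝ (V t) x ξ, ξ⟫ ≤ Λ / (-t) * ‖ξ‖ ^ 2

/-- Row D7cΛ is a theorem of the tree. [folklore] -/
theorem row_D7cL_excluded : Row_D7cL := fun M _ hΛ => SubcriticalStrain.rdssClass_subcriticalStrain_empty M hΛ

/-! ## D7d: the double-cone cell (conditional on row F17) -/

/-- **Row D7d** (vorticity DIRECTION of a locally suitable smooth representative confined to a double
cone `{|ξ × e| ≤ 1 − δ}` wherever `|ω| > M₀` at the regular points of `Q(1)`, any `M`): the sub-class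
is empty.  In tree CONDITIONALLY on the Lei–Ren–Tian 2025 double-cone regularity theorem (row F17,
fact `LeiRenTian2025_doubleCone_regularity`, no `_holds`): `row_D7d_of_F17`.  Value:
EXCLUDED-IN-PRINT-NOT-TREE (preprint; conditional-in-tree). (ref: LeiRenTian2025, Thm 1.1) -/
def Row_D7d : Prop :=
  ∀ M : ℝ, RdssClassEmptyUnder M fun u =>
    ∀ V : ℝ → EuclideanSpace ℝ (Fin 3) → EuclideanSpace ℝ (Fin 3),
      IsTypeIAncientMild M V → (∀ t < 0, V t =ᵐ[volume] u t) → (∀ t, 0 ≤ t → ∀ x, V t x = 0) →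
      ∃ (p : ℝ → EuclideanSpace ℝ (Fin 3) → ℝ) (e : EuclideanSpace ℝ (Fin 3)) (δ M₀ : ℝ),
        IsSuitableWeakSolutionInBall 1 0 V p ∧ ‖e‖ = 1 ∧ 0 < δ ∧ 0 < M₀ ∧
        ∀ z ∈ parabolicCylinder 1 (0 : ℝ × EuclideanSpace ℝ (Fin 3)),
          ¬ IsBackwardSingularPoint V z →
          ‖curl (V z.1) z.2‖ ≤ M₀ ∨ ‖cross (vorticityDirection (curl (V z.1)) z.2) e‖ ≤ 1 - δ

/-- Row D7d modulo row F17 (the Lei–Ren–Tian fact): the tree's conditional theorem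
`DoubleCone.rdssClass_doubleCone_empty`. [cite: LeiRenTian2025, Thm. 1.1 (arXiv:2501.08976, p. 4)] -/
theorem row_D7d_of_F17 (hLRT : LeiRenTian2025_doubleCone_regularity) : Row_D7d := fun M =>
  DoubleCone.rdssClass_doubleCone_empty hLRT M

/-- Every row of this file follows from the conjecture leaf (rows D7 ∧ R4): e.g. D6a. [folklore] -/
theorem row_D6a_of_conjecture
    (h : Summit.NavierStokesRegularity.NavierStokesRegularity.TypeIDSSLiouvilleConjecture) : Row_D6a :=
  fun M _ => rdssClassEmpty_forall_iff_conjecture.2 h M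

/-! ## Round 2 (appended 2026-08-28): the remaining D6 mixed-constant windows, the a.e.-self-similar cell,
D5 with an arbitrary fixed twist, and the infinite-twist non-commuting isotropy cell — two-liners over
`RdssClassEmpty(Under)` closed BY NAME (the D7c ANALYTIC side conditions are in
`ScenarioCensusSelfSimilarConeAnalytic.lean`, 400-line cap).  In every `…Under` row the side condition is
imposed on EVERY smooth Type-I representative `V` of the member (`IsTypeIAncientMild M V`, `V = u` a.e.),
as in the tree statements. -/

/-- **Row D6P** (mixed constant: `‖x‖ √(−t) ‖V‖² ≤ P` with `P² < 64/27`, any `M`): empty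
(`SimilarityEnstrophy.rdssClass_empty_of_mixedConstant_coulomb`; the weaker `P² < 16/27` twin is
`…_of_mixedConstant`).  EXCLUDED-IN-TREE. (ref: tree) -/
def Row_D6P : Prop :=
  ∀ M P : ℝ, P ^ 2 < 64 / 27 → RdssClassEmptyUnder M fun u =>
    ∀ V : ℝ → EuclideanSpace ℝ (Fin 3) → EuclideanSpace ℝ (Fin 3), IsTypeIAncientMild M V →
      (∀ t < 0, V t =ᵐ[volume] u t) →
      ∀ t < 0, ∀ x, ‖x‖ * Real.sqrt (-t) * ‖V t x‖ ^ 2 ≤ P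

/-- Row D6P is a theorem of the tree. [folklore] -/
theorem row_D6P_excluded : Row_D6P := fun M _ hP => SimilarityEnstrophy.rdssClass_empty_of_mixedConstant_coulomb M hP

/-- **Row D6θA** (time rate `θ` AND space rate `A` of the representatives with `(θA)² < 64/27`, any
`M`): empty (`SimilarityEnstrophy.rdssClass_empty_of_timeConstant_mul_spaceConstant`).  EXCLUDED-IN-TREE.
(ref: tree) -/
def Row_D6thA : Prop :=
  ∀ M θ A : ℝ, (θ * A) ^ 2 < 64 / 27 → RdssClassEmptyUnder M fun u =>
    ∀ V : ℝ → EuclideanSpace ℝ (Fin 3) → EuclideanSpace ℝ (Fin 3), IsTypeIAncientMild M V →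
      (∀ t < 0, V t =ᵐ[volume] u t) →
      (∀ t < 0, ∀ x, Real.sqrt (-t) * ‖V t x‖ ≤ θ) ∧ ∀ t < 0, ∀ x, ‖x‖ * ‖V t x‖ ≤ A

/-- Row D6θA is a theorem of the tree. [folklore] -/
theorem row_D6thA_excluded : Row_D6thA := fun M _ _ h =>
  SimilarityEnstrophy.rdssClass_empty_of_timeConstant_mul_spaceConstant M h

/-- **Row D6A** (SPACE-only rate of the representatives `‖x‖ ‖V(t,x)‖ ≤ A ≤ 1/2`, any `M`): empty
(`SimilarityEnstrophy.rdssClass_empty_of_spaceConstant`; the envelope form `M ≤ 1/2` is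
`…_of_explicitSpaceThreshold_unconditional` ⊂ D6a).  EXCLUDED-IN-TREE. (ref: tree) -/
def Row_D6A : Prop :=
  ∀ M A : ℝ, A ≤ 1 / 2 → RdssClassEmptyUnder M fun u => ∀ V : ℝ → EuclideanSpace ℝ (Fin 3) → EuclideanSpace ℝ (Fin 3), IsTypeIAncientMild M V →
      (∀ t < 0, V t =ᵐ[volume] u t) →
      ∀ t < 0, ∀ x, ‖x‖ * ‖V t x‖ ≤ A

/-- Row D6A is a theorem of the tree. [folklore] -/
theorem row_D6A_excluded : Row_D6A := fun M _ hA => SimilarityEnstrophy.rdssClass_empty_of_spaceConstant M hA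

/-- **Row D6MA** (Gaussian two-constant window: representatives of time-Type-I class `Mt` with space
rate `A`, `Mt² + 3A < 4`, any `M`): empty (`GaussianGap.rdssClass_empty_of_twoConstant`).
EXCLUDED-IN-TREE. (ref: tree) -/
def Row_D6MA : Prop :=
  ∀ M Mt A : ℝ, Mt ^ 2 + 3 * A < 4 → RdssClassEmptyUnder M fun u =>
    ∀ V : ℝ → EuclideanSpace ℝ (Fin 3) → EuclideanSpace ℝ (Fin 3), IsTypeIAncientMild M V →
      (∀ t < 0, V t =ᵐ[volume] u t) →
      IsTypeIAncientMild Mt V ∧ ∀ t < 0, ∀ x, ‖x‖ * ‖V t x‖ ≤ A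

/-- Row D6MA is a theorem of the tree. [folklore] -/
theorem row_D6MA_excluded : Row_D6MA := fun M _ _ h => GaussianGap.rdssClass_empty_of_twoConstant M h

/-- **Row D7cAe** (a.e. SELF-SIMILAR members: every Navier–Stokes rescaling `nsRescale λ u`, `λ > 0`,
agrees a.e. with `u` slice by slice; any `M`): empty (`ControlsClassLevel.rdssClass_aeSelfSimilar_empty`).
EXCLUDED-IN-TREE. (ref: tree; Tsai1998) -/
def Row_D7cAe : Prop :=
  ∀ M : ℝ, RdssClassEmptyUnder M fun u => ∀ lam : ℝ, 0 < lam → ∀ t < 0, nsRescale lam u t =ᵐ[volume] u t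

/-- Row D7cAe is a theorem of the tree. [folklore] -/
theorem row_D7cAe_excluded : Row_D7cAe := fun M => ControlsClassLevel.rdssClass_aeSelfSimilar_empty M

/-- **Row D5tw** (Type I · rotated λ-DSS with an ARBITRARY fixed twist `R` · FINE ratio: for every
`M > 0` and `R` there is `c₁(M,R) > 1` such that every member with factor `1 < c < c₁` has a.e. trivial
slices — Chae–Wolf's removing-DSS theorem D5 with any twist): the statement of
`FixedTwistEmpty.rdssClass_fixedTwist_nearIdentity_ae_zero` verbatim.  EXCLUDED-IN-TREE.
(ref: ChaeWolf2017RemovingDSS, Thm 1.3; tree) -/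
def Row_D5tw : Prop :=
  ∀ M : ℝ, 0 < M → ∀ R : (EuclideanSpace ℝ (Fin 3)) ≃ₗᵢ[ℝ] (EuclideanSpace ℝ (Fin 3)),
    ∃ c₁ : ℝ, 1 < c₁ ∧ ∀ c : ℝ, 1 < c → c < c₁ →
      ∀ u : ℝ → (EuclideanSpace ℝ (Fin 3)) → (EuclideanSpace ℝ (Fin 3)),
      IsAncientMildSolution 1 u → (∀ t < 0, AEStronglyMeasurable (u t) volume) →
      IsRotatedDSS c R u → HasTypeIDecay M u → ∀ t < 0, u t =ᵐ[volume] 0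

/-- Row D5tw is a theorem of the tree. [cite: ChaeWolf2017RemovingDSS, Theorem 1.3 (arXiv:1610.09464 p. 3)] -/
theorem row_D5tw_excluded : Row_D5tw := FixedTwistEmpty.rdssClass_fixedTwist_nearIdentity_ae_zero

/-- **Row D7cIT** (twist `rotZLIE θ` of infinite order, `θ/2π` irrational, and slices a.e. equivariant
under an isometry `m` NOT commuting with some rotation about the axis): no member — verbatim
`TiltedIsotropy.rdssClass_infiniteTwist_noncommutingIsotropy_empty`.  EXCLUDED-IN-TREE. (ref: tree) -/
def Row_D7cIT : Prop :=
  ∀ (θ : ℝ), Irrational (θ / (2 * Real.pi)) →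
    ∀ (m : (EuclideanSpace ℝ (Fin 3)) ≃ₗᵢ[ℝ] (EuclideanSpace ℝ (Fin 3))),
    (∃ (φ : ℝ) (y : (EuclideanSpace ℝ (Fin 3))), m (rotZ φ y) ≠ rotZ φ (m y)) → ∀ (M : ℝ),
    ¬ ∃ (c : ℝ) (u : ℝ → (EuclideanSpace ℝ (Fin 3)) → (EuclideanSpace ℝ (Fin 3))),
      1 < c ∧ IsAncientMildSolution 1 u ∧ (∀ t < 0, AEStronglyMeasurable (u t) volume) ∧
      IsRotatedDSS c (rotZLIE θ) u ∧ HasTypeIDecay M u ∧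
      (∀ t < 0, (fun x => u t (m x)) =ᵐ[volume] fun x => m (u t x)) ∧
      ¬ (∀ t < 0, u t =ᵐ[volume] 0)

/-- Row D7cIT is a theorem of the tree. [folklore] -/
theorem row_D7cIT_excluded : Row_D7cIT := fun _ hθ _ hm M =>
  TiltedIsotropy.rdssClass_infiniteTwist_noncommutingIsotropy_empty hθ hm M

/-! ## Round 3 (appended 2026-08-28): the spatio-temporal symmetry cells (members that are ALSO
rotated-DSS for a second pair `(μ, g)`; class binder `(c, μ, u)`, verbatim) -/

/-- **Row D7cST** (SPATIO-TEMPORAL REVERSING: twist `rotZLIE θ` of infinite order, `θ/π` irrational,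
and the member is in addition rotated-DSS with some factor `μ > 0` for a rotation-REVERSING isometry
`g`): no member — verbatim `SpatioTemporal.rdssClass_spatioTemporalReversing_empty`.
EXCLUDED-IN-TREE. (ref: tree) -/
def Row_D7cST : Prop :=
  ∀ (θ : ℝ), Irrational (θ / Real.pi) →
    ∀ (g : (EuclideanSpace ℝ (Fin 3)) ≃ₗᵢ[ℝ] (EuclideanSpace ℝ (Fin 3))),
    (∀ φ y, g (rotZ φ y) = rotZ (-φ) (g y)) → ∀ (M : ℝ),
    ¬ ∃ (c μ : ℝ) (u : ℝ → (EuclideanSpace ℝ (Fin 3)) → (EuclideanSpace ℝ (Fin 3))),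
      1 < c ∧ 0 < μ ∧ IsAncientMildSolution 1 u ∧ (∀ t < 0, AEStronglyMeasurable (u t) volume) ∧
      IsRotatedDSS c (rotZLIE θ) u ∧ HasTypeIDecay M u ∧ IsRotatedDSS μ g u ∧
      ¬ (∀ t < 0, u t =ᵐ[volume] 0)

/-- Row D7cST is a theorem of the tree. [folklore] -/
theorem row_D7cST_excluded : Row_D7cST := fun _ hθ _ hg M =>
  SpatioTemporal.rdssClass_spatioTemporalReversing_empty hθ hg M

/-- **Row D7cNC** (SPATIO-TEMPORAL, NON-COMMUTING COMMUTATOR: twist `rotZLIE θ`, `θ/2π` irrational,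
second rotated-DSS structure `(μ, g)` whose conjugate `g R_θ g⁻¹ R_θ⁻¹` fails to commute with some
rotation about the axis): no member — verbatim
`TiltedIsotropy.rdssClass_spatioTemporal_noncommutingCommutator_empty`.  EXCLUDED-IN-TREE. (ref: tree) -/
def Row_D7cNC : Prop :=
  ∀ (θ : ℝ), Irrational (θ / (2 * Real.pi)) →
    ∀ (g : (EuclideanSpace ℝ (Fin 3)) ≃ₗᵢ[ℝ] (EuclideanSpace ℝ (Fin 3))),
    (∃ (φ : ℝ) (y : (EuclideanSpace ℝ (Fin 3))),
      g (rotZLIE θ (g.symm ((rotZLIE θ).symm (rotZ φ y)))) ≠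
        rotZ φ (g (rotZLIE θ (g.symm ((rotZLIE θ).symm y))))) → ∀ (M : ℝ),
    ¬ ∃ (c μ : ℝ) (u : ℝ → (EuclideanSpace ℝ (Fin 3)) → (EuclideanSpace ℝ (Fin 3))),
      1 < c ∧ 0 < μ ∧ IsAncientMildSolution 1 u ∧ (∀ t < 0, AEStronglyMeasurable (u t) volume) ∧
      IsRotatedDSS c (rotZLIE θ) u ∧ HasTypeIDecay M u ∧ IsRotatedDSS μ g u ∧
      ¬ (∀ t < 0, u t =ᵐ[volume] 0)

/-- Row D7cNC is a theorem of the tree. [folklore] -/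
theorem row_D7cNC_excluded : Row_D7cNC := fun _ hθ _ hm M =>
  TiltedIsotropy.rdssClass_spatioTemporal_noncommutingCommutator_empty hθ hm M

end Summit.NavierStokesRegularity.NavierStokesRegularity.Theorems.ScenarioCensus

end
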